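import Mathlib
import HarnessLib
import Summits.NavierStokesRegularity.NavierStokesRegularity.Theorems.PoloidalWindowDoorLrcModEntireTwistingTHGlobalForm
import Summits.NavierStokesRegularity.NavierStokesRegularity.Theorems.PoloidalWindowDoorLrcModEntireTwistingTHLocalHypGerm

/-!
# Item `LrcModEntire` (stmt-NavierStokesRegularity-20428), skeleton twist_split v6 — the PINNED GLOBAL ROAD to the registered (TH) stub
# `stub_twistingTHGerm`: the class-level form of ALL the pins of the local stub (hyperbolic window, μ < 0, μ analytic with μ_z ≠ 0 somewhere, twist ≠ 0)

LEAD ns-poloidal-K2-p3 g12 (prover-ns-poloidal-K2-p3-g12-0), `--supports stmt-NavierStokesRegularity-20428 --as helper`; sequel of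
`…LrcModEntireTwistingTHGlobalForm` (`twistingTHGerm_of_globalForm`, `twistingTHGerm_of_globalHypForm`).

* `analyticAt_windowSlope` — LOCAL version of ns-poloidal-K2-p2 g4's `…TimeHeightShearNormalForm.analyticAt_planeSlope`: if `∂₂v_b = μ(t,x₂)∂_b v₂`
  holds on an open window `W` of a class profile and `∂_{b₀}v₂(z₀) ≠ 0` at `z₀ ∈ W`, then `uncurry μ` is real-analytic at `(z₀.1, z₀.2 2)`.
* `exists_slopeDeriv_ne_zero` — a non-degenerate (TH) window whose slope is not a function of time alone on any open sub-window carries a point with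
  `∂μ/∂x₂ ≠ 0` (mean value theorem on a product box + the local analyticity).
* `twistingTHGerm_of_globalPinForm` — the PINNED global road: it suffices to refute a class + poloidal + hot-spot-normalised profile with a global plane-slope
  function `μ` (flat-or-proportional dichotomy on every plane of every slice) and a non-degenerate pinned twisting window on which the type scalar is negative,
  `μ < 0`, the slope is `μ`, `uncurry μ` is analytic at every window point and `∂μ/∂x₂ ≠ 0` at some window point.  This is the class-level counterpart of the
  local stub's pin set (`μ < 0`, `μ_z ≠ 0`, twist `≠ 0`) and the setting of the located obstruction (K2-p2 TH-STEP2; LEAD memo NORMALFORM-TH-g12 §6 (OSC)).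
WHAT THIS IS NOT: not a claim about Navier–Stokes regularity and not the stub — sorry-free reductions (bears_on LADDER-NS N0, item 20428 / crux 19708).
-/

noncomputable section

set_option linter.dupNamespace false

namespace Summit.NavierStokesRegularity.NavierStokesRegularity.Theorems.PoloidalWindowDoorLrcModEntireTwistingTHGlobalPinForm

open MeasureTheory Set Function Filter Topology Metric
open scoped RealInnerProductSpace InnerProductSpace Laplacian
open Literature.Analysis Literature.Analysis.FluidPDE
open Summit.NavierStokesRegularity.NavierStokesRegularity.Theorems.PoloidalWindowDoorPoloidalWindowRigidityTimeHeightShearNormalForm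

/-! ### The slope of a twisting window: local analyticity and a point with non-zero height gradient -/

variable {C : ℝ} {v : ℝ → EuclideanSpace ℝ (Fin 3) → EuclideanSpace ℝ (Fin 3)}

/-- **Local analyticity of a WINDOW slope.**  If `∂₂v_b = μ(t,x₂) ∂_b v₂` (`b = 0,1`) holds on an open space–time set `W` of a class profile
and `∂_{b₀}v₂(z₀) ≠ 0` at a point `z₀ ∈ W` of negative time, then `uncurry μ` is real-analytic at `(z₀.1, z₀.2 2)` (it is locally the ratio of two
jointly analytic Jacobian entries along the family `(s,c) ↦ (s, z₀.2 + (c − z₀.2 2)e₂)`, which stays in `W`).  Local version of ns-poloidal-K2-p2's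
`…TimeHeightShearNormalForm.analyticAt_planeSlope` (whose hypothesis is the identity on all of `ℝ³`). -/
theorem analyticAt_windowSlope (hrate : HasTypeITimeDecay C v)
    (hcont : ContinuousOn (uncurry v) (Iio (0 : ℝ) ×ˢ univ))
    (hmild : ∀ s t : ℝ, s < t → t < 0 → ∀ x,
      v t x = UnboundedOperators.heatExtension (v s) (t - s) x - oseenDuhamel 1 s v v t x)
    {W : Set (ℝ × EuclideanSpace ℝ (Fin 3))} (hW : IsOpen W) {μ : ℝ → ℝ → ℝ}
    (hμ : ∀ z ∈ W, ∀ b : Fin 3, b ≠ 2 →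
      fderiv ℝ (v z.1) z.2 (EuclideanSpace.single 2 1) b = μ z.1 (z.2 2) * fderiv ℝ (v z.1) z.2 (EuclideanSpace.single b 1) 2)
    {z₀ : ℝ × EuclideanSpace ℝ (Fin 3)} (hz₀ : z₀ ∈ W) (hs₀ : z₀.1 < 0) {b₀ : Fin 3} (hb₀ : b₀ ≠ 2)
    (hne : fderiv ℝ (v z₀.1) z₀.2 (EuclideanSpace.single b₀ 1) 2 ≠ 0) :
    AnalyticAt ℝ (uncurry μ) (z₀.1, z₀.2 2) := by
  set s₀ := z₀.1 with hs₀def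
  set y₀ := z₀.2 with hy₀def
  set ι : ℝ × ℝ → ℝ × EuclideanSpace ℝ (Fin 3) :=
    fun p => (p.1, y₀ + (p.2 - y₀ 2) • EuclideanSpace.single 2 (1 : ℝ)) with hι
  have hιa : AnalyticAt ℝ ι (s₀, y₀ 2) := by
    refine analyticAt_fst.prod ?_
    exact analyticAt_const.add ((analyticAt_snd.sub analyticAt_const).smul analyticAt_const)
  have hι₀ : ι (s₀, y₀ 2) = (s₀, y₀) := by simp [hι]
  have hι₀' : ι (s₀, y₀ 2) = z₀ := by rw [hι₀]
  have hmem : ι (s₀, y₀ 2) ∈ Iio (0 : ℝ) ×ˢ (univ : Set (EuclideanSpace ℝ (Fin 3))) := by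
    rw [hι₀]; exact mk_mem_prod hs₀ (mem_univ _)
  have hheight : ∀ p : ℝ × ℝ, (ι p).2 2 = p.2 := by
    intro p; simp [hι]
  have hA : AnalyticAt ℝ (fun p : ℝ × ℝ => fderiv ℝ (v (ι p).1) (ι p).2 (EuclideanSpace.single 2 1) b₀) (s₀, y₀ 2) :=
    (Summit.NavierStokesRegularity.NavierStokesRegularity.Theorems.PoloidalWindowDoorPoloidalWindowRigidityK2OfLrcSlope.analyticOnNhd_uncurry_fderiv_entry hrate hcont hmild 2 b₀ _ hmem).comp hιa
  have ha : AnalyticAt ℝ (fun p : ℝ × ℝ => fderiv ℝ (v (ι p).1) (ι p).2 (EuclideanSpace.single b₀ 1) 2) (s₀, y₀ 2) :=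
    (Summit.NavierStokesRegularity.NavierStokesRegularity.Theorems.PoloidalWindowDoorPoloidalWindowRigidityK2OfLrcSlope.analyticOnNhd_uncurry_fderiv_entry hrate hcont hmild b₀ 2 _ hmem).comp hιa
  have hne₀ : fderiv ℝ (v (ι (s₀, y₀ 2)).1) (ι (s₀, y₀ 2)).2 (EuclideanSpace.single b₀ 1) 2 ≠ 0 := by
    rw [hι₀']; exact hne
  have hne' : ∀ᶠ p in 𝓝 (s₀, y₀ 2),
      fderiv ℝ (v (ι p).1) (ι p).2 (EuclideanSpace.single b₀ 1) 2 ≠ 0 := ha.continuousAt.eventually_ne hne₀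
  -- the family stays in the open window near `(s₀, y₀ 2)`
  have hW' : ∀ᶠ p in 𝓝 (s₀, y₀ 2), ι p ∈ W := by
    have hc : ContinuousAt ι (s₀, y₀ 2) := hιa.continuousAt
    have : W ∈ 𝓝 (ι (s₀, y₀ 2)) := by rw [hι₀']; exact hW.mem_nhds hz₀
    exact hc.preimage_mem_nhds this
  have hev : uncurry μ =ᶠ[𝓝 (s₀, y₀ 2)] fun p =>
      fderiv ℝ (v (ι p).1) (ι p).2 (EuclideanSpace.single 2 1) b₀ /
        fderiv ℝ (v (ι p).1) (ι p).2 (EuclideanSpace.single b₀ 1) 2 := by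
    filter_upwards [hne', hW'] with p hp1 hp2
    rw [hμ (ι p) hp2 b₀ hb₀, hheight p, mul_div_cancel_right₀ _ hp1]
    rcases p with ⟨s, c⟩
    rfl
  exact (hA.div ha hne₀).congr hev.symm

/-- **A twisting window carries a point with non-zero slope gradient.**  If the slope `μ(t,x₂)` of a non-degenerate (TH) window `W` (pin
`∇ₕv₂ ≠ 0` pointwise) is NOT a function of time alone on any open sub-window, then `∂μ/∂x₂ ≠ 0` at (the height of) some point of `W` — by the
local analyticity of `μ` and the mean value theorem on a product box. -/
theorem exists_slopeDeriv_ne_zero (hrate : HasTypeITimeDecay C v)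
    (hcont : ContinuousOn (uncurry v) (Iio (0 : ℝ) ×ˢ univ))
    (hmild : ∀ s t : ℝ, s < t → t < 0 → ∀ x,
      v t x = UnboundedOperators.heatExtension (v s) (t - s) x - oseenDuhamel 1 s v v t x)
    {W : Set (ℝ × EuclideanSpace ℝ (Fin 3))} (hW : IsOpen W) (hWne : W.Nonempty) (hWs : W ⊆ Iio (0 : ℝ) ×ˢ univ)
    (hpin : ∀ z ∈ W,
      fderiv ℝ (v z.1) z.2 (EuclideanSpace.single 0 1) 2 ≠ 0 ∨ fderiv ℝ (v z.1) z.2 (EuclideanSpace.single 1 1) 2 ≠ 0)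
    (hntv : ∀ m : ℝ → ℝ, ∀ W₁ : Set (ℝ × EuclideanSpace ℝ (Fin 3)), W₁ ⊆ W → IsOpen W₁ → W₁.Nonempty →
      ∃ z ∈ W₁, ∃ b : Fin 3, b ≠ 2 ∧
        fderiv ℝ (v z.1) z.2 (EuclideanSpace.single 2 1) b ≠ m z.1 * fderiv ℝ (v z.1) z.2 (EuclideanSpace.single b 1) 2)
    {μ : ℝ → ℝ → ℝ}
    (hμ : ∀ z ∈ W, ∀ b : Fin 3, b ≠ 2 →
      fderiv ℝ (v z.1) z.2 (EuclideanSpace.single 2 1) b = μ z.1 (z.2 2) * fderiv ℝ (v z.1) z.2 (EuclideanSpace.single b 1) 2) :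
    ∃ z ∈ W, deriv (μ z.1) (z.2 2) ≠ 0 := by
  by_contra hall
  push Not at hall
  obtain ⟨z₀, hz₀⟩ := hWne
  have hs₀ : z₀.1 < 0 := (Set.mem_prod.1 (hWs hz₀)).1
  -- a product box around `z₀` inside `W`
  obtain ⟨ε, hε, hballW⟩ := Metric.isOpen_iff.1 hW z₀ hz₀
  set I : Set ℝ := Set.Ioo (z₀.1 - ε) (z₀.1 + ε) with hI
  set B : Set (EuclideanSpace ℝ (Fin 3)) := Metric.ball z₀.2 ε with hB
  have hbox : I ×ˢ B ⊆ W := by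
    intro z hz
    apply hballW
    have h1 : z ∈ Metric.ball z₀.1 ε ×ˢ Metric.ball z₀.2 ε := by
      rw [Real.ball_eq_Ioo]; exact hz
    rwa [ball_prod_same] at h1
  -- on the box, the slope is the time-only function `t ↦ μ t (z₀.2 2)`
  have hconst : ∀ z ∈ I ×ˢ B, μ z.1 (z.2 2) = μ z.1 (z₀.2 2) := by
    intro z hz
    have hzW : z ∈ W := hbox hz
    obtain ⟨hzI, hzB⟩ := Set.mem_prod.1 hz
    have hs : z.1 < 0 := (Set.mem_prod.1 (hWs hzW)).1
    -- the height interval J around z₀.2 2, realised inside the box by the points z₀.2 + (c - z₀.2 2) e₂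
    set J : Set ℝ := Set.Ioo (z₀.2 2 - ε) (z₀.2 2 + ε) with hJ
    have hpt : ∀ c ∈ J, (z.1, z₀.2 + (c - z₀.2 2) • EuclideanSpace.single 2 (1 : ℝ)) ∈ W := by
      intro c hc
      apply hbox
      refine Set.mem_prod.2 ⟨hzI, ?_⟩
      rw [hB, Metric.mem_ball, dist_eq_norm]
      have : z₀.2 + (c - z₀.2 2) • EuclideanSpace.single 2 (1 : ℝ) - z₀.2 = (c - z₀.2 2) • EuclideanSpace.single 2 (1 : ℝ) := by abel
      rw [this]
      have hn : ‖(c - z₀.2 2) • EuclideanSpace.single (2 : Fin 3) (1 : ℝ)‖ = |c - z₀.2 2| := by simp [norm_smul]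
      rw [hn]
      rw [hJ, Set.mem_Ioo] at hc
      rw [abs_lt]; constructor <;> linarith [hc.1, hc.2]
    have hheight : ∀ c : ℝ, (z₀.2 + (c - z₀.2 2) • EuclideanSpace.single (2 : Fin 3) (1 : ℝ) : EuclideanSpace ℝ (Fin 3)) 2 = c := by
      intro c; simp
    -- μ z.1 is differentiable on J with zero derivative
    have hdiff : DifferentiableOn ℝ (μ z.1) J := by
      intro c hc
      have hzc := hpt c hc
      obtain ⟨b₀, hb₀, hneb⟩ : ∃ b₀ : Fin 3, b₀ ≠ 2 ∧
          fderiv ℝ (v z.1) (z₀.2 + (c - z₀.2 2) • EuclideanSpace.single 2 (1 : ℝ)) (EuclideanSpace.single b₀ 1) 2 ≠ 0 := by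
        rcases hpin _ hzc with h0 | h1
        · exact ⟨0, by decide, h0⟩
        · exact ⟨1, by decide, h1⟩
      have han := analyticAt_windowSlope hrate hcont hmild hW hμ hzc hs hb₀ hneb
      rw [hheight] at han
      -- `μ z.1 = uncurry μ ∘ (c ↦ (z.1, c))`
      have hcomp : AnalyticAt ℝ (fun c' : ℝ => uncurry μ (z.1, c')) c :=
        han.comp (analyticAt_const.prod analyticAt_id)
      exact hcomp.differentiableAt.differentiableWithinAt
    have hder : J.EqOn (deriv (μ z.1)) 0 := by
      intro c hc
      have := hall _ (hpt c hc)
      simpa [hheight c] using this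
    have hy2 : z.2 2 ∈ J := by
      rw [hJ, Set.mem_Ioo]
      have hd : dist z.2 z₀.2 < ε := by rwa [hB, Metric.mem_ball] at hzB
      have hcoord : |z.2 2 - z₀.2 2| ≤ dist z.2 z₀.2 := by
        have := PiLp.norm_apply_le (z.2 - z₀.2) 2
        simpa [Real.norm_eq_abs, dist_eq_norm] using this
      rw [abs_le] at hcoord
      constructor <;> linarith [hcoord.1, hcoord.2]
    have hy02 : z₀.2 2 ∈ J := by
      rw [hJ, Set.mem_Ioo]; constructor <;> linarith
    exact isOpen_Ioo.is_const_of_deriv_eq_zero isPreconnected_Ioo hdiff hder hy2 hy02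
  -- contradiction with «not time-only on the sub-window I × B»
  have hIB_open : IsOpen (I ×ˢ B) := isOpen_Ioo.prod Metric.isOpen_ball
  have hIB_ne : (I ×ˢ B).Nonempty :=
    ⟨z₀, Set.mem_prod.2 ⟨by rw [hI, Set.mem_Ioo]; constructor <;> linarith, Metric.mem_ball_self hε⟩⟩
  obtain ⟨z, hz, b, hb, hneq⟩ := hntv (fun t => μ t (z₀.2 2)) (I ×ˢ B) hbox hIB_open hIB_ne
  exact hneq (by rw [hμ z (hbox hz) b hb, hconst z hz])

/-! ### The PINNED global road: hyperbolic window, negative slope, analytic slope with non-zero height gradient somewhere on the window -/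

/-- **PINNED GLOBAL ROAD to `stub_twistingTHGerm`.**  The contradiction `hG` need only be derived for a class + poloidal + hot-spot-normalised profile
with a global plane-slope function `μ` (flat-or-proportional dichotomy on every plane of every slice) and a non-degenerate pinned twisting window `W`
on which: the type scalar is negative, `μ < 0`, the slope IS `μ`, `uncurry μ` is real-analytic at `(t, x₂)` for every window point, and `∂μ/∂x₂ ≠ 0`
at some window point — i.e. the class-level form of ALL the pins of the local stub (`μ < 0`, `μ_z ≠ 0`, twist `≠ 0`).  Proof: hyperbolic relocation
(`exists_hyperbolicTHWindow`), global slopes (`timeHeightShear_normalForm`), `analyticAt_windowSlope`, `exists_slopeDeriv_ne_zero`, `exfalso`. -/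
theorem twistingTHGerm_of_globalPinForm
    (hG :
    ∀ (C : ℝ) (v : ℝ → EuclideanSpace ℝ (Fin 3) → EuclideanSpace ℝ (Fin 3)),
      Literature.Analysis.FluidPDE.HasTypeITimeDecay C v →
      ContinuousOn (Function.uncurry v) (Set.Iio (0 : ℝ) ×ˢ Set.univ) →
      (∀ s t : ℝ, s < t → t < 0 → ∀ x, v t x =
        Literature.Analysis.UnboundedOperators.heatExtension (v s) (t - s) x -
          Literature.Analysis.FluidPDE.oseenDuhamel 1 s v v t x) →
      (∀ t < 0, Literature.Analysis.FluidPDE.VectorCalculus.IsDivFree (v t)) →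
      (∀ s < 0, ∀ y, ⟪Literature.Analysis.FluidPDE.curl (v s) y, EuclideanSpace.single 2 1⟫_ℝ = 0) →
      v (-1) 0 2 ≠ 0 → (∀ t < 0, ∀ x, Real.sqrt (-t) * |v t x 2| ≤ |v (-1) 0 2|) →
      (∀ h : EuclideanSpace ℝ (Fin 3), fderiv ℝ (v (-1)) 0 h 2 = 0) →
      (deriv (fun s => v s 0 2) (-1) = v (-1) 0 2 / 2 ∧ v (-1) 0 2 * (Δ (fun y => v (-1) y 2)) 0 ≤ 0) →
      ∀ μ : ℝ → ℝ → ℝ,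
        (∀ s < 0, ∀ c : ℝ,
          (∀ y : EuclideanSpace ℝ (Fin 3), y 2 = c →
              fderiv ℝ (v s) y (EuclideanSpace.single 0 1) 2 = 0 ∧ fderiv ℝ (v s) y (EuclideanSpace.single 1 1) 2 = 0) ∨
            (∀ y : EuclideanSpace ℝ (Fin 3), y 2 = c → ∀ b : Fin 3, b ≠ 2 →
              fderiv ℝ (v s) y (EuclideanSpace.single 2 1) b = μ s c * fderiv ℝ (v s) y (EuclideanSpace.single b 1) 2)) →
      ∀ W : Set (ℝ × EuclideanSpace ℝ (Fin 3)), IsOpen W → W.Nonempty → W ⊆ Set.Iio (0 : ℝ) ×ˢ Set.univ →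
        (∀ z ∈ W, (Literature.Analysis.FluidPDE.curl (v z.1) z.2 ≠ 0 ∧
            (fderiv ℝ (v z.1) z.2 (EuclideanSpace.single 0 1) 2 ≠ 0 ∨ fderiv ℝ (v z.1) z.2 (EuclideanSpace.single 1 1) 2 ≠ 0) ∧
            (fderiv ℝ (v z.1) z.2 (EuclideanSpace.single 2 1) 0 ≠ 0 ∨ fderiv ℝ (v z.1) z.2 (EuclideanSpace.single 2 1) 1 ≠ 0))) →
        (∀ m : ℝ → ℝ, ∀ W₁ : Set (ℝ × EuclideanSpace ℝ (Fin 3)), W₁ ⊆ W → IsOpen W₁ → W₁.Nonempty →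
            ∃ z ∈ W₁, ∃ b : Fin 3, b ≠ 2 ∧
              fderiv ℝ (v z.1) z.2 (EuclideanSpace.single 2 1) b ≠
                m z.1 * fderiv ℝ (v z.1) z.2 (EuclideanSpace.single b 1) 2) →
        (∀ z ∈ W, (fderiv ℝ (fun x => fderiv ℝ (v z.1) x (EuclideanSpace.single 2 1) 2) z.2 (EuclideanSpace.single 0 1) *
                fderiv ℝ (v z.1) z.2 (EuclideanSpace.single 1 1) 2 -
              fderiv ℝ (fun x => fderiv ℝ (v z.1) x (EuclideanSpace.single 2 1) 2) z.2 (EuclideanSpace.single 1 1) *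
                fderiv ℝ (v z.1) z.2 (EuclideanSpace.single 0 1) 2 ≠ 0)) →
        (∀ z ∈ W,
          fderiv ℝ (v z.1) z.2 (EuclideanSpace.single 2 1) 0 * fderiv ℝ (v z.1) z.2 (EuclideanSpace.single 0 1) 2 +
            fderiv ℝ (v z.1) z.2 (EuclideanSpace.single 2 1) 1 * fderiv ℝ (v z.1) z.2 (EuclideanSpace.single 1 1) 2 < 0) →
        (∀ z ∈ W, μ z.1 (z.2 2) < 0) →
        (∀ z ∈ W, ∀ b : Fin 3, b ≠ 2 →
            fderiv ℝ (v z.1) z.2 (EuclideanSpace.single 2 1) b =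
              μ z.1 (z.2 2) * fderiv ℝ (v z.1) z.2 (EuclideanSpace.single b 1) 2) →
        (∀ z ∈ W, AnalyticAt ℝ (Function.uncurry μ) (z.1, z.2 2)) →
        (∃ z ∈ W, deriv (μ z.1) (z.2 2) ≠ 0) →
        False) :
    ∀ (C : ℝ) (v : ℝ → EuclideanSpace ℝ (Fin 3) → EuclideanSpace ℝ (Fin 3)),
      Literature.Analysis.FluidPDE.HasTypeITimeDecay C v →
      ContinuousOn (Function.uncurry v) (Set.Iio (0 : ℝ) ×ˢ Set.univ) →
      (∀ s t : ℝ, s < t → t < 0 → ∀ x, v t x =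
        Literature.Analysis.UnboundedOperators.heatExtension (v s) (t - s) x -
          Literature.Analysis.FluidPDE.oseenDuhamel 1 s v v t x) →
      (∀ t < 0, Literature.Analysis.FluidPDE.VectorCalculus.IsDivFree (v t)) →
      (∀ s < 0, ∀ y, ⟪Literature.Analysis.FluidPDE.curl (v s) y, EuclideanSpace.single 2 1⟫_ℝ = 0) →
      v (-1) 0 2 ≠ 0 → (∀ t < 0, ∀ x, Real.sqrt (-t) * |v t x 2| ≤ |v (-1) 0 2|) →
      (∀ h : EuclideanSpace ℝ (Fin 3), fderiv ℝ (v (-1)) 0 h 2 = 0) →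
      (deriv (fun s => v s 0 2) (-1) = v (-1) 0 2 / 2 ∧ v (-1) 0 2 * (Δ (fun y => v (-1) y 2)) 0 ≤ 0) →
      ∀ W : Set (ℝ × EuclideanSpace ℝ (Fin 3)), IsOpen W → W.Nonempty → W ⊆ Set.Iio (0 : ℝ) ×ˢ Set.univ →
        (∀ z ∈ W, (Literature.Analysis.FluidPDE.curl (v z.1) z.2 ≠ 0 ∧
            (fderiv ℝ (v z.1) z.2 (EuclideanSpace.single 0 1) 2 ≠ 0 ∨ fderiv ℝ (v z.1) z.2 (EuclideanSpace.single 1 1) 2 ≠ 0) ∧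
            (fderiv ℝ (v z.1) z.2 (EuclideanSpace.single 2 1) 0 ≠ 0 ∨ fderiv ℝ (v z.1) z.2 (EuclideanSpace.single 2 1) 1 ≠ 0))) →
        (∀ m : ℝ → ℝ, ∀ W₁ : Set (ℝ × EuclideanSpace ℝ (Fin 3)), W₁ ⊆ W → IsOpen W₁ → W₁.Nonempty →
            ∃ z ∈ W₁, ∃ b : Fin 3, b ≠ 2 ∧
              fderiv ℝ (v z.1) z.2 (EuclideanSpace.single 2 1) b ≠
                m z.1 * fderiv ℝ (v z.1) z.2 (EuclideanSpace.single b 1) 2) →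
        (∀ z ∈ W, (fderiv ℝ (fun x => fderiv ℝ (v z.1) x (EuclideanSpace.single 2 1) 2) z.2 (EuclideanSpace.single 0 1) *
                fderiv ℝ (v z.1) z.2 (EuclideanSpace.single 1 1) 2 -
              fderiv ℝ (fun x => fderiv ℝ (v z.1) x (EuclideanSpace.single 2 1) 2) z.2 (EuclideanSpace.single 1 1) *
                fderiv ℝ (v z.1) z.2 (EuclideanSpace.single 0 1) 2 ≠ 0)) →
        (∃ m : ℝ → ℝ → ℝ, ∀ z ∈ W, ∀ b : Fin 3, b ≠ 2 →
            fderiv ℝ (v z.1) z.2 (EuclideanSpace.single 2 1) b =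
              m z.1 (z.2 2) * fderiv ℝ (v z.1) z.2 (EuclideanSpace.single b 1) 2) →
        ∃ s : ℝ, s < 0 ∧ ∃ U : Set (EuclideanSpace ℝ (Fin 3)), IsOpen U ∧ U.Nonempty ∧
          ((∃ e : EuclideanSpace ℝ (Fin 3), e ≠ 0 ∧
              ∀ y ∈ U, fderiv ℝ (Literature.Analysis.FluidPDE.curl (v s)) y e = 0) ∨
           (∃ c : EuclideanSpace ℝ (Fin 3), ∀ y ∈ U,
              Literature.Analysis.FluidPDE.rotGen (Literature.Analysis.FluidPDE.curl (v s) y) =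
                fderiv ℝ (Literature.Analysis.FluidPDE.curl (v s)) y (Literature.Analysis.FluidPDE.rotGen (y - c))) ∨
           (∃ w : EuclideanSpace ℝ (Fin 3) → EuclideanSpace ℝ (Fin 3), AnalyticOnNhd ℝ w Set.univ ∧
              ¬ BddAbove (Set.range fun y => ‖w y‖) ∧ ∀ y ∈ U, v s y = w y)) := by
  intro C v hrate hcont hmild hdiv hpol hne hhot hthread hpins W hW hWne hWs hnd hntv htw hTH
  exfalso
  obtain ⟨W', hW', hWne', hWs', hnd', hntv', htw', hhyp', hTH'⟩ :=
    Summit.NavierStokesRegularity.NavierStokesRegularity.Theorems.PoloidalWindowDoorLrcModEntireTwistingTHLocalHypGerm.exists_hyperbolicTHWindow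
      C v hrate hcont hmild hdiv W hW hWne hWs hnd hntv htw hTH
  obtain ⟨m, hm⟩ := hTH'
  have hNF := timeHeightShear_normalForm hrate hcont hmild hW' hWne' hWs' hm
  classical
  let μ : ℝ → ℝ → ℝ := fun s c =>
    if h : ∃ μ' : ℝ, ∀ y : EuclideanSpace ℝ (Fin 3), y 2 = c → ∀ b : Fin 3, b ≠ 2 →
        fderiv ℝ (v s) y (EuclideanSpace.single 2 1) b = μ' * fderiv ℝ (v s) y (EuclideanSpace.single b 1) 2
    then h.choose else 0
  have hμ : ∀ s < 0, ∀ c : ℝ,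
      (∀ y : EuclideanSpace ℝ (Fin 3), y 2 = c →
          fderiv ℝ (v s) y (EuclideanSpace.single 0 1) 2 = 0 ∧ fderiv ℝ (v s) y (EuclideanSpace.single 1 1) 2 = 0) ∨
        (∀ y : EuclideanSpace ℝ (Fin 3), y 2 = c → ∀ b : Fin 3, b ≠ 2 →
          fderiv ℝ (v s) y (EuclideanSpace.single 2 1) b = μ s c * fderiv ℝ (v s) y (EuclideanSpace.single b 1) 2) := by
    intro s hs c
    rcases hNF s hs c with hflat | hex
    · exact Or.inl hflat
    · right
      have hdef : μ s c = hex.choose := by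
        simp only [μ, dif_pos hex]
      rw [hdef]
      exact hex.choose_spec
  have hWμ : ∀ z ∈ W', ∀ b : Fin 3, b ≠ 2 →
      fderiv ℝ (v z.1) z.2 (EuclideanSpace.single 2 1) b =
        μ z.1 (z.2 2) * fderiv ℝ (v z.1) z.2 (EuclideanSpace.single b 1) 2 := by
    intro z hz b hb
    have hz1 : z.1 < 0 := (Set.mem_prod.1 (hWs' hz)).1
    rcases hμ z.1 hz1 (z.2 2) with hflat | hslope
    · exfalso
      rcases (hnd' z hz).2.1 with h0 | h1
      · exact h0 (hflat z.2 rfl).1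
      · exact h1 (hflat z.2 rfl).2
    · exact hslope z.2 rfl b hb
  have hμneg : ∀ z ∈ W', μ z.1 (z.2 2) < 0 := by
    intro z hz
    exact Summit.NavierStokesRegularity.NavierStokesRegularity.Theorems.PoloidalWindowDoorLrcModEntireTwistingTHLocalHypGerm.slope_neg_of_typeScalar_neg
      (hWμ z hz 0 (by decide)) (hWμ z hz 1 (by decide)) (hhyp' z hz)
  have hμan : ∀ z ∈ W', AnalyticAt ℝ (Function.uncurry μ) (z.1, z.2 2) := by
    intro z hz
    have hz1 : z.1 < 0 := (Set.mem_prod.1 (hWs' hz)).1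
    rcases (hnd' z hz).2.1 with h0 | h1
    · exact analyticAt_windowSlope hrate hcont hmild hW' hWμ hz hz1 (b₀ := 0) (by decide) h0
    · exact analyticAt_windowSlope hrate hcont hmild hW' hWμ hz hz1 (b₀ := 1) (by decide) h1
  have hμz : ∃ z ∈ W', deriv (μ z.1) (z.2 2) ≠ 0 :=
    exists_slopeDeriv_ne_zero hrate hcont hmild hW' hWne' hWs' (fun z hz => (hnd' z hz).2.1) hntv' hWμ
  exact hG C v hrate hcont hmild hdiv hpol hne hhot hthread hpins μ hμ W' hW' hWne' hWs' hnd' hntv' htw' hhyp' hμneg hWμ hμan hμz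

end Summit.NavierStokesRegularity.NavierStokesRegularity.Theorems.PoloidalWindowDoorLrcModEntireTwistingTHGlobalPinForm
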